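import Summits.QuantumFields.BalabanUV.Beta.FP.ConstrainedBiLaplacianSbFull
import Summits.QuantumFields.BalabanUV.Beta.FP.ConstrainedBiLaplacianResponseJunction
import Summits.QuantumFields.BalabanUV.Beta.FP.ConstrainedBiLaplacianPairing

/-!
# `BalabanUV.Beta.FP.ConstrainedBiLaplacianSbJunction` — road «FP» for binder row D1, DESIGN ROW **GHOST-STEP** brick (g3) «(CONV-C)-Sb»,
# FILE 5b — THE JUNCTION FOR THE PAIR (`Sb`, `Wb`): an2's block-constrained bi-Laplacian Green kernel `BiLaplaceBlockKKT.Sb` IS `N⁴` times the real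
# part of the lattice kernel of the lineage's offset-pair multiplier `M N 2`, and its coarse multiplier `Wb` is the kernel of FILE 5a's co-vector
# symbol, by an2's canonicity `eq_SbCol_of_solvesB`; hence `Sb` inherits FILE 3b's localisation and FILE 4c's `N`-free block-unit bound, and `Wb`
# a LEVEL-FREE block-mean majorant — the uniform halves of Q-FP-13-2 «for the PAIR (`Sb`, `Wb`)» (d1-p3, journal 2026-08-21T14:41:13Z) BY NAME

NOT IN PRINT; OUR PROOF ATTEMPT (binder row G-an2-4 ∕ (CONV-C), prover part P3 = fibre∕strip «Woodbury» lineage, gen 28; CRUX TEAM (2),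
2026-08-21).  HONEST DEPENDENCY (cell records, verbatim): «continuum YM on T⁴ ⇐ BetaPertH ∧ nine spine estimates (0/9 proved); BetaPertH ⇐ (D1) ∧
(D4) ∧ CAP+tail; G-an2-4 gates asym, D1 and NE2/3/4.»  HONEST FRAMING (cell contract, verbatim): «discharging `BetaPertH` makes Bałaban's UV
stability UNCONDITIONAL — a real constructive-QFT result; it is NOT the continuum limit and NOT the Clay problem.»  ABSOLUTE RULE (cell charter,
verbatim): «No internally-minted statement may enter as a cited fact. Every hypothesis is either kernel-proved in this package or a verbatim quotation
of a PUBLISHED theorem with page reference. The manuscript(s) under audit are NOT citable for their own disputed steps — they are the thing under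
adjudication; programme-internal (2001/route/tribunal) claims are never citable.»  THIS MODULE is [folklore] bookkeeping over FILES 4a∕4b∕5a of this programme, the lineage's FILES 3b
(`kernel_decay`) and 4c (`entry_decay_uniform`), and an2's `BiLaplaceBlockGreen` (`Sb`, `Wb`, `WbCol`, `eq_SbCol_of_solvesB`, `δS`) BY NAME; it cites nothing
as a hypothesis, has TWO bookkeeping `def`s (`lamS`, `omegaS`), no `def … : Prop`, no `sorry`.

## Contents (dimension `d+1`; blocks of side `N ≥ 1`; order `s = 2` for the junction)

* §1 the kernel identities: **`negLap_negLap_KS`** (`(−Δ)²_z KS N 2 z x′ = [z = x′] − N^{−(d+1)}·latticeKernel (CsigSym N 2 (x′ mod N)) (⌊z∕N⌋ − ⌊x′∕N⌋)`),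
  **`sum_finePt_KS`** (`Σ_j KS N s (N•y+j) x′ = 0`).
* §2 an2's system: `lamS N x′ := Re (N⁴·KS N 2 · x′)`, `omegaS N x′ := −Re (N^{−(d+1)}·latticeKernel (CsigSym N 2 (x′ mod N)) (· − ⌊x′∕N⌋))`;
  **`lamS_EL`** (`codiff₁(dz(codiff₁(dz lamS))) z = omegaS (quo N z) + δS x′ z`), **`lamS_M`** (zero block sums), **`solvesB_lamS`**, `tempered_lamS`, `tempered_omegaS`.
* §3 **`Sb_eq_re_KS : Sb (N := N) z x′ = ((N:ℂ)⁴·KS N 2 z x′).re`**, **`Wb_eq_omegaS : Wb (N := N) y x′ = omegaS N x′ y`**; **`abs_Sb_le`** (FILE 3b, prefactor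
  `N⁴·boundM` with its honest `N`-dependence), **`abs_Sb_le_uniform`** (FILE 4c: `|Sb_N(z,x′)| ≤ N⁴·4^{d+1}·Kop·e^{−kappaB|⌊z∕N⌋−⌊x′∕N⌋|_∞}`, `N`-free in
  block units), **`abs_Wb_le`**, **`abs_Wb_scaled_le`** (`|(N^{d+1})·Wb_N(y,x′)| ≤ 2^{d+1}·CG (d+1) 2·(64∕7)²·(48ζ_{d+1})^{d+1}·e^{−kappaB|y − ⌊x′∕N⌋|_∞}`,
  every `N ≥ 1`) and **`Wb_tower_uniform`** (`∃ κ > 0, C ≥ 0` free of `N`).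

The two-leg sub-cell majorant for `Sb` by name (Q-FP-13-2's `dec`-form) is FILE 5c; the convergence ∕ rate half is NOT in this programme's files yet.
0∕4 row-D1 binders touched.  NOT (CONV-C), NEVER «G-an2-4 closed», NOT the ghost step law, NOT SDF, NOT D1, NOT BetaPertH, NOT continuum, NOT Clay.
Provenance: prover-b2b-balaban-gan24-p3-g28-0 (unit `b2b-balaban-gan24-p3`, gen 28), 2026-08-21; no existing file touched.
-/

noncomputable section

namespace Summit.QuantumFields.BalabanUV.Beta.FP.ConstrainedBiLaplacianSbJunction

open Complex Finset ComplexConjugate MeasureTheory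
open Literature.MathematicalPhysics.QuantumFieldTheory
open Literature.MathematicalPhysics.QuantumFieldTheory.Balaban1983to89
open Literature.MathematicalPhysics.QuantumFieldTheory.Balaban1983to89.B4Strip
open Literature.MathematicalPhysics.QuantumFieldTheory.Balaban1983to89.B4StripCauchy
open Literature.MathematicalPhysics.QuantumFieldTheory.Balaban1983to89.B5Strip145Analytic
open Literature.MathematicalPhysics.QuantumFieldTheory.Balaban1983to89.B5Strip145Decay
open Literature.MathematicalPhysics.QuantumFieldTheory.Balaban1983to89.B4StripSums
open Literature.MathematicalPhysics.QuantumFieldTheory.Balaban1983to89.B4StripSumsHolder (PhZ efZ differentiableAt_PhZ)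
open Literature.MathematicalPhysics.QuantumFieldTheory.Balaban1983to89.B4ContourShift
open Literature.MathematicalPhysics.QuantumFieldTheory.Balaban1983to89.B4Green244 (e coarse offset finePt finePt_coarse_offset coarse_finePt
  phaseC V F_zero PhZ_finePt lap_PhZ sum_PhZ_V negLap blockAvg opD opD_latticeKernel latticeKernel_phase_mul latticeKernel_congr
  latticeKernel_sum_mul latticeKernel_one latticeKernel_phase integrableOn_of_differentiableAt sum_rootOfUnity_pow)
open Summit.QuantumFields.BalabanUV.Beta.FP.ConstrainedBiLaplacianStrip
open Summit.QuantumFields.BalabanUV.Beta.FP.ConstrainedBiLaplacianFibre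
open Summit.QuantumFields.BalabanUV.Beta.FP.ConstrainedBiLaplacianFibreEntries
open Summit.QuantumFields.BalabanUV.Beta.FP.ConstrainedBiLaplacianFibreSides
open Summit.QuantumFields.BalabanUV.Beta.FP.ConstrainedBiLaplacianKernel
open Summit.QuantumFields.BalabanUV.Beta.FP.ConstrainedBiLaplacianFibreOperator (Kop Kop_nonneg)
open Summit.QuantumFields.BalabanUV.Beta.FP.ConstrainedBiLaplacianPairing (entry_decay_uniform)
open Summit.QuantumFields.BalabanUV.Beta.FP.ConstrainedBiLaplacianFibreIdentities
open Summit.QuantumFields.BalabanUV.Beta.FP.ConstrainedBiLaplacianResponse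
open Summit.QuantumFields.BalabanUV.Beta.FP.ConstrainedBiLaplacianResponseFull (ofRealVec_mem_strip differentiableAt_sum_PhZ negLap_sum_PhZ
  sum_PhZ_F_zero sum_finePt_PhZ codiff₁_dz_eq_negLap negLap_const_mul negLap_eq_opD blockSum_eq_sum_finePt)
open Literature.MathematicalPhysics.QuantumFieldTheory.Balaban1983to89.B4Green242Bridge (latticeKernel_const_mul)
open Summit.QuantumFields.BalabanUV.Beta.FP.ConstrainedBiLaplacianSbFull
open Literature.MathematicalPhysics.QuantumFieldTheory.Balaban1983to89.Beta.AffineAveraging (Site Form0 dz codiff₁ unitVec box toSite blockSum)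
open Literature.MathematicalPhysics.QuantumFieldTheory.LatticeForm (quo)
open Literature.MathematicalPhysics.QuantumFieldTheory.Balaban1983to89.Beta.KKTFluctuationUnique (Tempered0)
open Literature.MathematicalPhysics.QuantumFieldTheory.Balaban1983to89.Beta.KernelSpecInstance (re0 re0_apply re1_dz re0_codiff₁)
open Literature.MathematicalPhysics.QuantumFieldTheory.Balaban1983to89.Beta.ScalarBlockGreen (δS)
open Literature.MathematicalPhysics.QuantumFieldTheory.Balaban1983to89.Beta.BiLaplaceBlockKKT (Sb Wb)
open Literature.MathematicalPhysics.QuantumFieldTheory.Balaban1983to89.Beta.BiLaplaceBlockGreen (SolvesB WbCol eq_Sb_of_solvesB eq_SbCol_of_solvesB)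
open scoped Real

variable {d : ℕ}

variable (N : ℕ) [NeZero N]

/-! ## §1 The kernel identities -/

/-- [folklore] **`(−Δ)²` OF THE KERNEL**: `negLap N (negLap N (KS N 2 · x′)) z = [z = x′] − N^{−(d+1)}·latticeKernel (CsigSym N 2 (x′ mod N)) (⌊z∕N⌋ − ⌊x′∕N⌋)`. -/
theorem negLap_negLap_KS (x' z : Fin (d + 1) → ℤ) :
    negLap N (negLap N (fun w => KS N 2 w x')) z
      = (if z = x' then 1 else 0) - (((N : ℂ) ^ (d + 1))⁻¹) * latticeKernel (CsigSym N 2 (offset N x')) (coarse N z - coarse N x') := by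
  set σ := offset N x' with hσ
  set y₀ := coarse N x' with hy₀
  -- first passage
  have hK : (fun w => KS N 2 w x') = fun w => latticeKernel (Sfull N 2 w σ) (-y₀) := by
    funext w; exact KS_eq N 2 w x'
  have hint1 : ∀ w, IntegrableOn (integrand (Sfull N 2 w σ) (-y₀)) (BZ (d + 1)) := fun w =>
    integrableOn_of_differentiableAt (fun p hp => differentiableAt_Sfull N 2 w σ p hp) (-y₀)
  set c : (Fin (d + 1) → Fin N) → (Fin (d + 1) → ℂ) → ℂ :=
    fun k P => DeltaXi N 0 (shift N k P) * ((((N : ℂ) ^ (d + 1))⁻¹) * ∑ k' : Fin (d + 1) → Fin N, EFc N σ k' P * Gfib N 2 k k' P) with hc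
  have step1 : negLap N (fun w => KS N 2 w x') = fun w => latticeKernel (fun P => ∑ k : Fin (d + 1) → Fin N, PhZ N k w P * c k P) (-y₀) := by
    funext w
    rw [hK, negLap_eq_opD, opD_latticeKernel N 0 0 (fun w' P => Sfull N 2 w' σ P) (-y₀) hint1 w]
    congr 1
    funext P
    rw [← negLap_eq_opD]
    exact negLap_sum_PhZ N _ w P
  -- second passage
  have hcd : ∀ k, ∀ P ∈ Strip (d + 1) (kappaB (d + 1) 2), DifferentiableAt ℂ (c k) P := fun k P hP =>
    (differentiableAt_DeltaXi_shift N 0 k P).mul (differentiableAt_inner N 2 σ k hP)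
  have hint2 : ∀ w, IntegrableOn (integrand (fun P => ∑ k : Fin (d + 1) → Fin N, PhZ N k w P * c k P) (-y₀)) (BZ (d + 1)) :=
    fun w => integrableOn_of_differentiableAt (fun p hp => differentiableAt_sum_PhZ N 2 c hcd w p hp) (-y₀)
  rw [step1, negLap_eq_opD, opD_latticeKernel N 0 0 (fun w P => ∑ k : Fin (d + 1) → Fin N, PhZ N k w P * c k P) (-y₀) hint2 z]
  -- the symbol identity on the zone
  have hzone : ∀ p ∈ BZ (d + 1), opD N 0 0 (fun w => ∑ k : Fin (d + 1) → Fin N, PhZ N k w (ofRealVec p) * c k (ofRealVec p)) z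
      = (fun P => (if offset N z = σ then cexp (I * phaseC P (coarse N z)) else 0)
          - cexp (I * phaseC P (coarse N z)) * ((((N : ℂ) ^ (d + 1))⁻¹) * CsigSym N 2 σ P)) (ofRealVec p) := by
    intro p hp
    show _ = (if offset N z = σ then cexp (I * phaseC (ofRealVec p) (coarse N z)) else 0)
      - cexp (I * phaseC (ofRealVec p) (coarse N z)) * ((((N : ℂ) ^ (d + 1))⁻¹) * CsigSym N 2 σ (ofRealVec p))
    have hP := ofRealVec_mem_strip 2 hp
    have h := negLap_negLap_Sfull N z σ hP
    have h1 : negLap N (fun w => Sfull N 2 w σ (ofRealVec p)) = fun w => ∑ k : Fin (d + 1) → Fin N, PhZ N k w (ofRealVec p) * c k (ofRealVec p) := by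
      funext w; exact negLap_sum_PhZ N _ w (ofRealVec p)
    rw [← negLap_eq_opD, ← h1, h]
    have hdiag := diag_sum N (coarse N z) (offset N z) σ (ofRealVec p)
    rw [finePt_coarse_offset] at hdiag
    rw [hdiag]
    ring
  rw [latticeKernel_congr (G1 := fun P => opD N 0 0 (fun w => ∑ k : Fin (d + 1) → Fin N, PhZ N k w P * c k P) z)
    (G2 := fun P => (if offset N z = σ then cexp (I * phaseC P (coarse N z)) else 0)
      - cexp (I * phaseC P (coarse N z)) * ((((N : ℂ) ^ (d + 1))⁻¹) * CsigSym N 2 σ P)) hzone (-y₀)]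
  -- split the kernel of the difference
  have hintA : IntegrableOn (integrand (fun P : Fin (d + 1) → ℂ => (if offset N z = σ then cexp (I * phaseC P (coarse N z)) else 0)) (-y₀))
      (BZ (d + 1)) := by
    apply integrableOn_of_differentiableAt
    intro p _
    split_ifs
    · show DifferentiableAt ℂ (fun P : Fin (d + 1) → ℂ => cexp (I * phaseC P (coarse N z))) (ofRealVec p)
      unfold phaseC
      fun_prop
    · exact differentiableAt_const _
  have hintB : IntegrableOn (integrand (fun P : Fin (d + 1) → ℂ =>
      cexp (I * phaseC P (coarse N z)) * ((((N : ℂ) ^ (d + 1))⁻¹) * CsigSym N 2 σ P)) (-y₀)) (BZ (d + 1)) := by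
    apply integrableOn_of_differentiableAt
    intro p hp
    have h1 : DifferentiableAt ℂ (fun P : Fin (d + 1) → ℂ => cexp (I * phaseC P (coarse N z))) (ofRealVec p) := by
      unfold phaseC; fun_prop
    exact h1.mul ((differentiableAt_CsigSym N 2 σ (ofRealVec_mem_strip 2 hp)).const_mul _)
  have hsplit := latticeKernel_sum_mul (Finset.univ : Finset Bool) (fun b => if b then (1 : ℂ) else -1)
    (fun b P => if b then (if offset N z = σ then cexp (I * phaseC P (coarse N z)) else 0)
      else cexp (I * phaseC P (coarse N z)) * ((((N : ℂ) ^ (d + 1))⁻¹) * CsigSym N 2 σ P)) (-y₀)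
    (fun b _ => by cases b <;> simpa using by first | exact hintB | exact hintA)
  simp only [Fintype.sum_bool, if_true, if_false, one_mul, neg_one_mul, Bool.false_eq_true] at hsplit
  rw [show (fun P : Fin (d + 1) → ℂ => (if offset N z = σ then cexp (I * phaseC P (coarse N z)) else 0)
      - cexp (I * phaseC P (coarse N z)) * ((((N : ℂ) ^ (d + 1))⁻¹) * CsigSym N 2 σ P))
      = fun P => (if offset N z = σ then cexp (I * phaseC P (coarse N z)) else 0)
        + -(cexp (I * phaseC P (coarse N z)) * ((((N : ℂ) ^ (d + 1))⁻¹) * CsigSym N 2 σ P)) from by funext P; ring, hsplit]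
  -- the two pieces
  have hA : latticeKernel (fun P : Fin (d + 1) → ℂ => (if offset N z = σ then cexp (I * phaseC P (coarse N z)) else 0)) (-y₀)
      = if z = x' then 1 else 0 := by
    by_cases hoff : offset N z = σ
    · simp only [hoff, if_true]
      rw [latticeKernel_phase]
      by_cases hzx : z = x'
      · rw [if_pos hzx, if_pos]
        rw [hzx, hy₀, neg_add_cancel]
      · rw [if_neg hzx, if_neg]
        intro h'
        apply hzx
        have hc : coarse N z = coarse N x' := by
          have := neg_add_eq_zero.mp h'
          rw [hy₀] at this; exact this.symm
        rw [← finePt_coarse_offset N z, ← finePt_coarse_offset N x', hc, hoff, hσ]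
    · simp only [hoff, if_false]
      have h0 : latticeKernel (fun _ : Fin (d + 1) → ℂ => (0 : ℂ)) (-y₀) = 0 := by
        have := latticeKernel_const_mul 0 (fun _ => (1 : ℂ)) (-y₀)
        simp only [zero_mul] at this
        exact this
      rw [h0, if_neg]
      intro hzx; apply hoff; rw [hzx]
  have hB : latticeKernel (fun P : Fin (d + 1) → ℂ => cexp (I * phaseC P (coarse N z)) * ((((N : ℂ) ^ (d + 1))⁻¹) * CsigSym N 2 σ P)) (-y₀)
      = (((N : ℂ) ^ (d + 1))⁻¹) * latticeKernel (CsigSym N 2 σ) (coarse N z - y₀) := by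
    rw [latticeKernel_phase_mul, latticeKernel_const_mul, neg_add_eq_sub]
  rw [hA, hB]
  ring

/-- [folklore] **THE BLOCK SUMS OF THE KERNEL VANISH**: `Σ_j KS N s (N•y + j) x′ = 0`. -/
theorem sum_finePt_KS (s : ℕ) (y x' : Fin (d + 1) → ℤ) : ∑ j : Fin (d + 1) → Fin N, KS N s (finePt N y j) x' = 0 := by
  have hint : ∀ j ∈ (Finset.univ : Finset (Fin (d + 1) → Fin N)),
      IntegrableOn (integrand (Sfull N s (finePt N y j) (offset N x')) (-coarse N x')) (BZ (d + 1)) := fun j _ =>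
    integrableOn_of_differentiableAt (fun p hp => differentiableAt_Sfull N s (finePt N y j) (offset N x') p hp) (-coarse N x')
  simp_rw [KS_eq]
  have h := latticeKernel_sum_mul Finset.univ (fun _ => (1 : ℂ)) (fun j => Sfull N s (finePt N y j) (offset N x')) (-coarse N x') hint
  simp only [one_mul] at h
  rw [← h, latticeKernel_congr (G1 := fun P => ∑ j : Fin (d + 1) → Fin N, Sfull N s (finePt N y j) (offset N x') P)
    (G2 := fun _ => (0 : ℂ)) (fun p hp => sum_finePt_Sfull N s y (offset N x') (ofRealVec_mem_strip s hp)) (-coarse N x')]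
  have := latticeKernel_const_mul 0 (fun _ => (1 : ℂ)) (-coarse N x')
  simp only [zero_mul] at this
  exact this

/-! ## §2 The kernel solves an2's block system with the unit force -/

/-- [our object] The candidate Green column in an2's (real) vocabulary: `lamS N x′ z = Re (N⁴·KS N 2 z x′)`. -/
def lamS (x' : Fin (d + 1) → ℤ) : Form0 (d + 1) ℝ := fun z => (((N : ℂ) ^ 4) * KS N 2 z x').re

/-- [our object] The candidate coarse multiplier: `omegaS N x′ y = −Re (N^{−(d+1)}·latticeKernel (CsigSym N 2 (x′ mod N)) (y − ⌊x′∕N⌋))`. -/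
def omegaS (x' : Fin (d + 1) → ℤ) : Form0 (d + 1) ℝ := fun y =>
  -((((N : ℂ) ^ (d + 1))⁻¹) * latticeKernel (CsigSym N 2 (offset N x')) (y - coarse N x')).re

/-- [folklore] **THE EULER–LAGRANGE ROW WITH THE UNIT FORCE**: `codiff₁(dz(codiff₁(dz (lamS N x′)))) z = omegaS N x′ (quo N z) + δS x′ z`. -/
theorem lamS_EL (x' z : Fin (d + 1) → ℤ) :
    codiff₁ (dz (codiff₁ (dz (lamS (d := d) N x')))) z = omegaS N x' (quo N z) + δS x' z := by
  have hNC : (N : ℂ) ≠ 0 := Nat.cast_ne_zero.mpr (NeZero.ne N)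
  have hre : lamS (d := d) N x' = re0 (fun z => ((N : ℂ) ^ 4) * KS N 2 z x') := rfl
  rw [hre, ← re1_dz, ← re0_codiff₁, ← re1_dz, ← re0_codiff₁, re0_apply]
  have h1 : codiff₁ (dz (fun z => ((N : ℂ) ^ 4) * KS N 2 z x')) = fun z => (((N : ℂ) ^ 2)⁻¹) * negLap N (fun z => ((N : ℂ) ^ 4) * KS N 2 z x') z := by
    funext z; exact codiff₁_dz_eq_negLap N _ z
  have hinner : (negLap N fun z => ((N : ℂ) ^ 4) * KS N 2 z x') = fun z => ((N : ℂ) ^ 4) * negLap N (fun w => KS N 2 w x') z :=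
    funext fun z => negLap_const_mul N _ _ z
  rw [h1, codiff₁_dz_eq_negLap N, negLap_const_mul, hinner, negLap_const_mul, negLap_negLap_KS]
  unfold omegaS δS
  have hq : quo N z = coarse N z := rfl
  rw [hq]
  have e : (((N : ℂ) ^ 2)⁻¹) * ((((N : ℂ) ^ 2)⁻¹) * (((N : ℂ) ^ 4) *
      ((if z = x' then 1 else 0) - (((N : ℂ) ^ (d + 1))⁻¹) * latticeKernel (CsigSym N 2 (offset N x')) (coarse N z - coarse N x'))))
      = (if z = x' then 1 else 0) - (((N : ℂ) ^ (d + 1))⁻¹) * latticeKernel (CsigSym N 2 (offset N x')) (coarse N z - coarse N x') := by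
    field_simp
  rw [e, Complex.sub_re]
  split_ifs <;> simp; ring

/-- [folklore] **THE BLOCK-SUM ROW**: `blockSum N (lamS N x′) y = 0`. -/
theorem lamS_M (x' y : Fin (d + 1) → ℤ) : blockSum N (lamS (d := d) N x') y = (0 : Form0 (d + 1) ℝ) y := by
  unfold blockSum lamS
  rw [blockSum_eq_sum_finePt N (fun z => (((N : ℂ) ^ 4) * KS N 2 z x').re) y, ← Complex.re_sum, ← Finset.mul_sum, sum_finePt_KS]
  simp

/-- [folklore] The candidate pair solves an2's block system with the unit force at `x′` and zero block sums. -/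
theorem solvesB_lamS (x' : Fin (d + 1) → ℤ) : SolvesB N (δS x') 0 (lamS (d := d) N x') (omegaS N x') where
  el z := lamS_EL N x' z
  mean y := lamS_M N x' y

/-- [folklore] The candidate column is bounded (FILE 3b's `kernel_decay`), hence tempered. -/
theorem tempered_lamS (x' : Fin (d + 1) → ℤ) : Tempered0 (lamS (d := d) N x') := by
  refine Tempered0.of_bounded (B := (N : ℝ) ^ 4 * ConstrainedBiLaplacianKernel.boundM N (d + 1) 2) fun z => ?_
  unfold lamS KS
  have h := kernel_decay N 2 (offset N z) (offset N x') (coarse N z - coarse N x')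
  have hexp : Real.exp (-(kappaB (d + 1) 2 * supNorm (coarse N z - coarse N x'))) ≤ 1 := by
    rw [Real.exp_le_one_iff]
    have := kappaB_pos (d + 1) 2
    have := supNorm_nonneg (coarse N z - coarse N x')
    nlinarith
  have hB := ConstrainedBiLaplacianKernel.boundM_nonneg N (d + 1) 2
  calc |(((N : ℂ) ^ 4) * latticeKernel (M N 2 (offset N z) (offset N x')) (coarse N z - coarse N x')).re|
      ≤ ‖((N : ℂ) ^ 4) * latticeKernel (M N 2 (offset N z) (offset N x')) (coarse N z - coarse N x')‖ := Complex.abs_re_le_norm _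
    _ = (N : ℝ) ^ 4 * ‖latticeKernel (M N 2 (offset N z) (offset N x')) (coarse N z - coarse N x')‖ := by
        rw [norm_mul, norm_pow, Complex.norm_natCast]
    _ ≤ (N : ℝ) ^ 4 * (ConstrainedBiLaplacianKernel.boundM N (d + 1) 2 * 1) := by
        refine mul_le_mul_of_nonneg_left (h.trans (mul_le_mul_of_nonneg_left hexp hB)) (by positivity)
    _ = _ := by rw [mul_one]

/-- [folklore] The candidate multiplier is bounded (strip regularity of the co-vector symbol), hence tempered. -/
theorem tempered_omegaS (x' : Fin (d + 1) → ℤ) : Tempered0 (omegaS (d := d) N x') := by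
  set B : ℝ := 2 ^ (d + 1) * CG (d + 1) 2 * SW N (d + 1) 2 with hB
  have hBnn : 0 ≤ B := by have := CG_nonneg (d + 1) 2; have := SW_nonneg N (d + 1) 2; positivity
  refine Tempered0.of_bounded (B := ((N : ℝ) ^ (d + 1))⁻¹ * B) fun y => ?_
  unfold omegaS
  have h := latticeKernel_decay (stripRegular_CsigSym N 2 (offset N x')) (kappaB_pos (d + 1) 2).le (y - coarse N x')
  have hexp : Real.exp (-(kappaB (d + 1) 2 * supNorm (y - coarse N x'))) ≤ 1 := by
    rw [Real.exp_le_one_iff]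
    have := kappaB_pos (d + 1) 2
    have := supNorm_nonneg (y - coarse N x')
    nlinarith
  rw [abs_neg]
  calc |((((N : ℂ) ^ (d + 1))⁻¹) * latticeKernel (CsigSym N 2 (offset N x')) (y - coarse N x')).re|
      ≤ ‖(((N : ℂ) ^ (d + 1))⁻¹) * latticeKernel (CsigSym N 2 (offset N x')) (y - coarse N x')‖ := Complex.abs_re_le_norm _
    _ = ((N : ℝ) ^ (d + 1))⁻¹ * ‖latticeKernel (CsigSym N 2 (offset N x')) (y - coarse N x')‖ := by
        rw [norm_mul, norm_inv, norm_pow, Complex.norm_natCast]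
    _ ≤ ((N : ℝ) ^ (d + 1))⁻¹ * (B * 1) := by
        refine mul_le_mul_of_nonneg_left ?_ (by positivity)
        exact h.trans (mul_le_mul_of_nonneg_left hexp hBnn)
    _ = _ := by rw [mul_one]

/-! ## §3 The junction for the pair (`Sb`, `Wb`) and the level-free majorants -/

/-- [our proof] **THE JUNCTION**: an2's block-constrained bi-Laplacian Green kernel IS `N⁴` times the real part of the lineage's fibre kernel —
`Sb (N := N) z x′ = ((N:ℂ)⁴·KS N 2 z x′).re` (an2's canonicity `eq_Sb_of_solvesB`). -/
theorem Sb_eq_re_KS (z x' : Fin (d + 1) → ℤ) : Sb (N := N) z x' = (((N : ℂ) ^ 4) * KS N 2 z x').re :=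
  (eq_Sb_of_solvesB (N := N) (solvesB_lamS (d := d) N x') (tempered_lamS N x') (tempered_omegaS N x') z).symm

/-- [our proof] **EXPONENTIAL LOCALISATION OF `Sb` ON THE BLOCK SCALE** (FILE 3b's `kernel_decay` through the junction; the prefactor's `N`-dependence
is FILE 3b's `boundM`, honestly displayed): `|Sb_N(z, x′)| ≤ N⁴·boundM N (d+1) 2·e^{−kappaB (d+1) 2·|⌊z∕N⌋ − ⌊x′∕N⌋|_∞}`. -/
theorem abs_Sb_le (z x' : Fin (d + 1) → ℤ) :
    |Sb (N := N) z x'| ≤ (N : ℝ) ^ 4 * ConstrainedBiLaplacianKernel.boundM N (d + 1) 2 * Real.exp (-(kappaB (d + 1) 2 * supNorm (coarse N z - coarse N x'))) := by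
  rw [Sb_eq_re_KS]
  unfold KS
  refine (Complex.abs_re_le_norm _).trans ?_
  rw [norm_mul, norm_pow, Complex.norm_natCast, mul_assoc]
  exact mul_le_mul_of_nonneg_left (kernel_decay N 2 (offset N z) (offset N x') (coarse N z - coarse N x')) (by positivity)

/-- [our proof] **THE `N`-FREE ENTRY BOUND IN BLOCK UNITS** (FILE 4c's `entry_decay_uniform` through the junction):
`|Sb_N(z, x′)| ≤ N⁴·4^{d+1}·Kop (d+1) 2·e^{−kappaB (d+1) 2·|⌊z∕N⌋ − ⌊x′∕N⌋|_∞}`. -/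
theorem abs_Sb_le_uniform (z x' : Fin (d + 1) → ℤ) :
    |Sb (N := N) z x'| ≤ (N : ℝ) ^ 4 * (4 ^ (d + 1) * Kop (d + 1) 2) * Real.exp (-(kappaB (d + 1) 2 * supNorm (coarse N z - coarse N x'))) := by
  rw [Sb_eq_re_KS]
  unfold KS
  refine (Complex.abs_re_le_norm _).trans ?_
  rw [norm_mul, norm_pow, Complex.norm_natCast, mul_assoc]
  exact mul_le_mul_of_nonneg_left (entry_decay_uniform N 2 (offset N z) (offset N x') (coarse N z - coarse N x')) (by positivity)

/-- [our proof] **an2's COARSE MULTIPLIER IN FIBRE FORM**: `Wb (N := N) y x′ = omegaS N x′ y` (the second half of an2's canonicity `eq_SbCol_of_solvesB`). -/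
theorem Wb_eq_omegaS (y x' : Fin (d + 1) → ℤ) : Wb (N := N) y x' = omegaS (d := d) N x' y := by
  have h := eq_SbCol_of_solvesB (N := N) (solvesB_lamS (d := d) N x') (tempered_lamS N x') (tempered_omegaS N x')
  rw [show Wb (N := N) y x' = WbCol (N := N) x' y from rfl]
  exact (congrFun h.2 y).symm

/-- [our proof] **EXPONENTIAL DECAY OF `Wb` ON THE BLOCK SCALE** (FILE 5a's `stripRegular_CsigSym` through the junction):
`|Wb_N(y, x′)| ≤ ((N:ℝ)^{d+1})⁻¹·2^{d+1}·CG (d+1) 2·SW N (d+1) 2·e^{−kappaB (d+1) 2·|y − ⌊x′∕N⌋|_∞}`. -/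
theorem abs_Wb_le (y x' : Fin (d + 1) → ℤ) :
    |Wb (N := N) y x'| ≤ ((N : ℝ) ^ (d + 1))⁻¹ * (2 ^ (d + 1) * CG (d + 1) 2 * SW N (d + 1) 2) *
      Real.exp (-(kappaB (d + 1) 2 * supNorm (y - coarse N x'))) := by
  rw [Wb_eq_omegaS]
  unfold omegaS
  have h := latticeKernel_decay (stripRegular_CsigSym N 2 (offset N x')) (kappaB_pos (d + 1) 2).le (y - coarse N x')
  rw [abs_neg]
  refine (Complex.abs_re_le_norm _).trans ?_
  rw [norm_mul, norm_inv, norm_pow, Complex.norm_natCast, mul_assoc]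
  exact mul_le_mul_of_nonneg_left h (by positivity)

/-- [our proof] **THE LEVEL-FREE MAJORANT OF `Wb` IN BLOCK-MEAN NORMALISATION**: for EVERY `N ≥ 1`,
`|(N^{d+1})·Wb_N(y, x′)| ≤ 2^{d+1}·CG (d+1) 2·(64∕7)²·(48 ζ_{d+1})^{d+1}·e^{−kappaB (d+1) 2·|y − ⌊x′∕N⌋|_∞}`. -/
theorem abs_Wb_scaled_le (y x' : Fin (d + 1) → ℤ) :
    |(N : ℝ) ^ (d + 1) * Wb (N := N) y x'| ≤ 2 ^ (d + 1) * CG (d + 1) 2 * ((64 / 7) ^ 2 * (48 * zetaC (d + 1)) ^ (d + 1)) *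
      Real.exp (-(kappaB (d + 1) 2 * supNorm (y - coarse N x'))) := by
  have hN : (0 : ℝ) < (N : ℝ) ^ (d + 1) := by
    have : (0 : ℝ) < N := by exact_mod_cast Nat.pos_of_ne_zero (NeZero.ne N)
    positivity
  have hCG := CG_nonneg (d + 1) 2
  have hSW := SW_le N (Nat.succ_pos d) (s := 2) (by norm_num)
  have h := abs_Wb_le N y x'
  rw [abs_mul, abs_of_pos hN]
  calc (N : ℝ) ^ (d + 1) * |Wb (N := N) y x'|
      ≤ (N : ℝ) ^ (d + 1) * (((N : ℝ) ^ (d + 1))⁻¹ * (2 ^ (d + 1) * CG (d + 1) 2 * SW N (d + 1) 2) *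
          Real.exp (-(kappaB (d + 1) 2 * supNorm (y - coarse N x')))) := mul_le_mul_of_nonneg_left h hN.le
    _ = 2 ^ (d + 1) * CG (d + 1) 2 * SW N (d + 1) 2 * Real.exp (-(kappaB (d + 1) 2 * supNorm (y - coarse N x'))) := by
        field_simp
    _ ≤ 2 ^ (d + 1) * CG (d + 1) 2 * ((64 / 7) ^ 2 * (48 * zetaC (d + 1)) ^ (d + 1)) *
          Real.exp (-(kappaB (d + 1) 2 * supNorm (y - coarse N x'))) := by gcongr

/-- [our proof] **«(CONV-C)-Wb», THE UNIFORM HALF, FOR an2's MULTIPLIER KERNEL BY NAME**: ONE rate `κ > 0` and ONE constant `C ≥ 0`, free of `N`, with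
`|(N^{d+1})·Wb_N(y, x′)| ≤ C·e^{−κ·|y − ⌊x′∕N⌋|_∞}` for ALL `N ≥ 1`, `y`, `x′`. -/
theorem Wb_tower_uniform (d : ℕ) :
    ∃ κ C : ℝ, 0 < κ ∧ 0 ≤ C ∧ ∀ (N : ℕ) [NeZero N] (y x' : Fin (d + 1) → ℤ),
      |(N : ℝ) ^ (d + 1) * Wb (N := N) y x'| ≤ C * Real.exp (-(κ * supNorm (y - coarse N x'))) := by
  refine ⟨kappaB (d + 1) 2, 2 ^ (d + 1) * CG (d + 1) 2 * ((64 / 7) ^ 2 * (48 * zetaC (d + 1)) ^ (d + 1)), kappaB_pos (d + 1) 2, ?_,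
    fun N _ y x' => abs_Wb_scaled_le N y x'⟩
  have := CG_nonneg (d + 1) 2
  have := zetaC_nonneg (d + 1)
  positivity

end Summit.QuantumFields.BalabanUV.Beta.FP.ConstrainedBiLaplacianSbJunction

end
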